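import Summits.MatrixMultiplication.OmegaCensus.SmallFormats.InvertiblePointFrame
import HarnessLib

/-!
# ω-census family (a): the footprint filter's ADMISSIBLE SPACES — type-free laws at a saturated invertible point

Cell `pub-omega` (unit `pub-omega-tensor-g32`), topic `Summits/MatrixMultiplication/OmegaCensus` (sub-folder `SmallFormats`).
Framing (verbatim): lottery ticket; floor = certified bounds/negative ranges. HONEST FRAMING: elementary linear algebra
continuing `InvertiblePointFrame` (p434823); these are the statements the census' search-free 'footprint filter' (tensor
g23 `ipfilter.py`; the (5,17)/(6,20)/(7,23) invertible-point instruments) evaluates type by type on a Kronecker catalog of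
pencils. Here they are proved for EVERY field and EVERY subspace `WW`, with no pencil enumeration — the kernel glue any
future kernel exclusion of an X-marginal at a saturated point needs. Not a rank bound; nothing on `ω`.

**Setting.** `β` computes `⟨m,m,n⟩ : (X, Y) ↦ XY` with terms `(f_i, g_i, W_i)`; `X₀` invertible, `O` = the terms with
`f_i(X₀) ≠ 0`, saturated: `|O| = m·n`; `WW ⊇ span{W_i : i ∉ O}`. The **admissible space** of a subspace `K ⊆ k^{m×m}`
relative to `WW` is `B_K(WW) = {W : X W ∈ WW for all X ∈ K}` (`fpSpace`).
* `inv_mul_w_mem_fpSpace` — the footprint law (`footprint_w_mem_span`) says exactly `X₀⁻¹ W_j ∈ B_{ker f_j}(WW)` for `j ∈ O`;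
  with `linearIndependent_inv_mul_w_off` these `m·n` vectors are a basis of `k^{m×n}`.
* `card_le_finrank_biSup_fpSpace` — RADO NECESSITY: for every set `T ⊆ O` of off-terms, `|T| ≤ dim Σ_{j∈T} B_{ker f_j}(WW)`
  (the filter declares a marginal dead at `X₀` when this fails for every catalog type of `WW`; only this easy direction of
  Rado–Hall is ever used for an exclusion).
* `exists_w_col_ne_zero_of_saturated` — FULL COLUMN SUPPORT (`m = 2`): the outputs of the terms vanishing at `X₀` cover every
  column (dead columns are inherited by all admissible spaces, `fpSpace_col_eq_zero`, and `T = O` would violate Rado) — the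
  'no `L₀` block' convention of the catalog is a theorem, not an assumption.
* `vecMulVec_add_vecMulVec_mem_fpSpace_iff` — STRUCTURE for a rank-one off-class `f(X) = θᵀXμ` (`θᵀμ ≠ 0`, `κ` spanning `θ^⊥`):
  `μ⊗a + κ⊗b ∈ B` iff `κ⊗a ∈ WW` and `k²⊗b ⊆ WW`; so `dim B = dim{a : κ⊗a ∈ WW} + dim{b : k²⊗b ⊆ WW}`.
* `vecMulVec_mem_of_mem_fpSpace` — for a class NOT factoring through `X ↦ Xu` (every invertible marginal, every `u ≠ 0`), a
  rank-one admissible vector `u⊗v` forces the whole plane `k²⊗v` into `WW`.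
-/

namespace Summit.MatrixMultiplication.OmegaCensus.SmallFormats

open Module Matrix Literature.Computability.AlgebraicComplexity

variable {k : Type*} [Field k] {m n : ℕ} {ι : Type*} [Fintype ι]

/-! ## The admissible space -/

/-- The **admissible (footprint) space** of `K ⊆ k^{m×m}` relative to `WW ⊆ k^{m×n}`: all `W` with `X W ∈ WW` for every
`X ∈ K`. For `K = ker f_j` and `WW ⊇ span{W_t : t ∉ O}` it contains the twisted output `X₀⁻¹ W_j` of the off-term `j`. -/
def fpSpace (K : Submodule k (Matrix (Fin m) (Fin m) k)) (WW : Submodule k (Matrix (Fin m) (Fin n) k)) :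
    Submodule k (Matrix (Fin m) (Fin n) k) where
  carrier := {W | ∀ X ∈ K, X * W ∈ WW}
  add_mem' hW hW' X hX := by
    rw [Matrix.mul_add]
    exact WW.add_mem (hW X hX) (hW' X hX)
  zero_mem' X _ := by
    rw [Matrix.mul_zero]
    exact WW.zero_mem
  smul_mem' c W hW X hX := by
    rw [Matrix.mul_smul]
    exact WW.smul_mem c (hW X hX)

/-- Membership in the admissible space. -/
@[simp] theorem mem_fpSpace {K : Submodule k (Matrix (Fin m) (Fin m) k)} {WW : Submodule k (Matrix (Fin m) (Fin n) k)}
    {W : Matrix (Fin m) (Fin n) k} : W ∈ fpSpace K WW ↔ ∀ X ∈ K, X * W ∈ WW := Iff.rfl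

/-- The admissible space grows with `WW` (so one may always ENLARGE `WW`, e.g. to dimension exactly `r − m·n`). -/
theorem fpSpace_mono (K : Submodule k (Matrix (Fin m) (Fin m) k)) {WW WW' : Submodule k (Matrix (Fin m) (Fin n) k)}
    (h : WW ≤ WW') : fpSpace K WW ≤ fpSpace K WW' :=
  fun _ hW X hX => h (hW X hX)

/-- The admissible space shrinks with `K`. -/
theorem fpSpace_antitone {K K' : Submodule k (Matrix (Fin m) (Fin m) k)} (h : K ≤ K')
    (WW : Submodule k (Matrix (Fin m) (Fin n) k)) : fpSpace K' WW ≤ fpSpace K WW :=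
  fun _ hW X hX => hW X (h hX)

/-! ## The footprint law and Rado necessity -/

/-- **Footprint law, admissible-space form.** At a saturated invertible point `X₀` (`|O| = m·n`), for every off-term
`j ∈ O`: `X₀⁻¹ W_j ∈ B_{ker f_j}(span{W_i : i ∉ O})` (from `footprint_w_mem_span` at the `X` with `f_j(X) = 0`). -/
theorem inv_mul_w_mem_fpSpace (β : BilinComp (mulBilin k m m n) ι) (X₀ : Matrix (Fin m) (Fin m) k)
    (hX₀ : IsUnit X₀.det) (O : Finset ι) (hO : ∀ i, i ∉ O → β.f i X₀ = 0) (hO' : ∀ i ∈ O, β.f i X₀ ≠ 0)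
    (hcard : O.card = m * n) {j : ι} (hj : j ∈ O) :
    X₀⁻¹ * β.w j ∈ fpSpace (LinearMap.ker (β.f j)) (Submodule.span k (β.w '' {i | i ∉ O})) := by
  classical
  intro X hX
  have h := footprint_w_mem_span β X₀ hX₀ O hO hO' hcard hj X
  rw [LinearMap.mem_ker] at hX
  rw [hX, zero_mul, zero_smul, sub_zero] at h
  exact Submodule.span_mono (Set.image_mono fun i hi => hi.1) h

set_option maxHeartbeats 400000 in
/-- At a saturated invertible point the twisted outputs `X₀⁻¹ W_j`, `j ∈ O`, are linearly independent (a basis of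
`k^{m×n}`, being `m·n` many). -/
theorem linearIndependent_inv_mul_w_off (β : BilinComp (mulBilin k m m n) ι) (X₀ : Matrix (Fin m) (Fin m) k)
    (hX₀ : IsUnit X₀.det) (O : Finset ι) (hO : ∀ i, i ∉ O → β.f i X₀ = 0) (hcard : O.card = m * n) :
    LinearIndependent k (fun j : O => X₀⁻¹ * β.w j) := by
  have hli := linearIndependent_w_off β X₀ hX₀ O hO hcard
  have hker : LinearMap.ker (mulLeftRect (n := n) X₀⁻¹) = ⊥ := by
    rw [LinearMap.ker_eq_bot']
    intro W hW
    rw [mulLeftRect_apply] at hW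
    have hXW : X₀ * (X₀⁻¹ * W) = W := by
      rw [← Matrix.mul_assoc, Matrix.mul_nonsing_inv X₀ hX₀, Matrix.one_mul]
    rw [← hXW, hW, Matrix.mul_zero]
  exact hli.map' _ hker

/-- **Rado necessity (the easy direction of Rado–Hall for subspaces).** If a linearly independent family indexed by
`O` has its `j`-th vector in the subspace `B j`, then every `T ⊆ O` has `|T| ≤ dim Σ_{j∈T} B j`. -/
theorem card_le_finrank_biSup_of_linearIndependent {M : Type*} [AddCommGroup M] [Module k M]
    [FiniteDimensional k M] {O : Finset ι} {v : O → M} (hv : LinearIndependent k v)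
    (B : ι → Submodule k M) (hB : ∀ j : O, v j ∈ B j) (T : Finset ι) (hT : T ⊆ O) :
    T.card ≤ finrank k (⨆ j ∈ T, B j : Submodule k M) := by
  set N : Submodule k M := ⨆ j ∈ T, B j with hN
  have hmem : ∀ j : T, v ⟨j, hT j.2⟩ ∈ N := fun j =>
    (le_iSup₂_of_le (f := fun i (_ : i ∈ T) => B i) (j : ι) j.2 le_rfl) (hB ⟨j, hT j.2⟩)
  let u : T → N := fun j => ⟨v ⟨j, hT j.2⟩, hmem j⟩
  have hu : LinearIndependent k u := by
    apply LinearIndependent.of_comp N.subtype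
    have hinj : Function.Injective (fun j : T => (⟨j, hT j.2⟩ : O)) := by
      intro a b h
      have h' : ((⟨(a : ι), hT a.2⟩ : O) : ι) = ((⟨(b : ι), hT b.2⟩ : O) : ι) := congrArg Subtype.val h
      exact Subtype.ext h'
    exact hv.comp _ hinj
  have h := hu.fintype_card_le_finrank
  rwa [Fintype.card_coe] at h

/-- **Rado necessity at a saturated point.** At a saturated invertible point `X₀` of a computation of `⟨m,m,n⟩`, for
every `WW ⊇ span{W_i : i ∉ O}` and every set `T ⊆ O` of off-terms: `|T| ≤ dim Σ_{j∈T} B_{ker f_j}(WW)`. The footprint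
filter excludes a marginal at `X₀` when, for every catalog type of `WW`, some `T` violates this. -/
theorem card_le_finrank_biSup_fpSpace (β : BilinComp (mulBilin k m m n) ι) (X₀ : Matrix (Fin m) (Fin m) k)
    (hX₀ : IsUnit X₀.det) (O : Finset ι) (hO : ∀ i, i ∉ O → β.f i X₀ = 0) (hO' : ∀ i ∈ O, β.f i X₀ ≠ 0)
    (hcard : O.card = m * n) (WW : Submodule k (Matrix (Fin m) (Fin n) k))
    (hWW : Submodule.span k (β.w '' {i | i ∉ O}) ≤ WW) (T : Finset ι) (hT : T ⊆ O) :
    T.card ≤ finrank k (⨆ j ∈ T, fpSpace (LinearMap.ker (β.f j)) WW : Submodule k (Matrix (Fin m) (Fin n) k)) :=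
  card_le_finrank_biSup_of_linearIndependent (linearIndependent_inv_mul_w_off β X₀ hX₀ O hO hcard)
    (fun j => fpSpace (LinearMap.ker (β.f j)) WW)
    (fun j => fpSpace_mono _ hWW (inv_mul_w_mem_fpSpace β X₀ hX₀ O hO hO' hcard j.2)) T hT

/-! ## Dead columns and full column support (`m = 2`) -/

/-- In `M₂(k)` no linear form vanishes on all `X` moving a given nonzero vector: for `w ≠ 0` there is `X` with `f X = 0`
and `X w ≠ 0` (take `X₁, X₂` with `X₁w = e₀`, `X₂w = e₁` and a combination in `ker f`). -/
theorem exists_ker_mulVec_ne_zero (f : Module.Dual k (Matrix (Fin 2) (Fin 2) k)) {w : Fin 2 → k} (hw : w ≠ 0) :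
    ∃ X : Matrix (Fin 2) (Fin 2) k, f X = 0 ∧ X *ᵥ w ≠ 0 := by
  obtain ⟨i, hi⟩ := Function.ne_iff.mp hw
  set X₁ : Matrix (Fin 2) (Fin 2) k := vecMulVec (Pi.single 0 1) (Pi.single i (w i)⁻¹) with hX₁
  set X₂ : Matrix (Fin 2) (Fin 2) k := vecMulVec (Pi.single 1 1) (Pi.single i (w i)⁻¹) with hX₂
  have h₁ : X₁ *ᵥ w = Pi.single 0 1 := by
    rw [hX₁, vecMulVec_mulVec, single_dotProduct, inv_mul_cancel₀ hi, MulOpposite.op_one, one_smul]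
  have h₂ : X₂ *ᵥ w = Pi.single 1 1 := by
    rw [hX₂, vecMulVec_mulVec, single_dotProduct, inv_mul_cancel₀ hi, MulOpposite.op_one, one_smul]
  by_cases hf : f X₁ = 0
  · refine ⟨X₁, hf, ?_⟩
    rw [h₁]
    intro h
    have h0 := congr_fun h 0
    rw [Pi.single_eq_same, Pi.zero_apply] at h0
    exact one_ne_zero h0
  · refine ⟨f X₁ • X₂ - f X₂ • X₁, ?_, ?_⟩
    · rw [map_sub, map_smul, map_smul, smul_eq_mul, smul_eq_mul, mul_comm, sub_self]
    · rw [Matrix.sub_mulVec, Matrix.smul_mulVec, Matrix.smul_mulVec, h₁, h₂]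
      intro h
      have h1 := congr_fun h 1
      simp only [Pi.sub_apply, Pi.smul_apply, Pi.single_eq_same, smul_eq_mul, mul_one, Pi.zero_apply] at h1
      rw [Pi.single_eq_of_ne (by decide : (1 : Fin 2) ≠ 0), mul_zero, sub_zero] at h1
      exact hf h1

/-- **Dead columns are inherited.** If every element of `WW ⊆ k^{2×n}` has zero column `c`, then so does every element of
the admissible space of `ker f`, for any linear form `f` on `M₂(k)`. -/
theorem fpSpace_col_eq_zero (f : Module.Dual k (Matrix (Fin 2) (Fin 2) k)) {WW : Submodule k (Matrix (Fin 2) (Fin n) k)}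
    {c : Fin n} (hWW : ∀ W ∈ WW, ∀ r, W r c = 0) {W : Matrix (Fin 2) (Fin n) k}
    (hW : W ∈ fpSpace (LinearMap.ker f) WW) (r : Fin 2) : W r c = 0 := by
  by_contra hne
  have hw : (fun r' => W r' c) ≠ 0 := fun h => hne (congr_fun h r)
  obtain ⟨X, hfX, hXw⟩ := exists_ker_mulVec_ne_zero f hw
  apply hXw
  ext r'
  have h := hWW (X * W) (hW X (LinearMap.mem_ker.mpr hfX)) r'
  rw [Matrix.mul_apply] at h
  simpa [Matrix.mulVec, dotProduct] using h

/-- The column-`c` map `W ↦ (W r c)_r` on `k^{2×n}`. -/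
def colMap (c : Fin n) : Matrix (Fin 2) (Fin n) k →ₗ[k] (Fin 2 → k) where
  toFun W r := W r c
  map_add' _ _ := rfl
  map_smul' _ _ := rfl

/-- `colMap c W r = W r c`. -/
@[simp] theorem colMap_apply (c : Fin n) (W : Matrix (Fin 2) (Fin n) k) (r : Fin 2) : colMap c W r = W r c := rfl

/-- The matrices with dead column `c` form a proper subspace of `k^{2×n}`. -/
theorem ker_colMap_ne_top (c : Fin n) : LinearMap.ker (colMap (k := k) c) ≠ ⊤ := by
  intro h
  have hmem : Matrix.single (0 : Fin 2) c (1 : k) ∈ LinearMap.ker (colMap (k := k) c) := by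
    rw [h]; exact Submodule.mem_top
  rw [LinearMap.mem_ker] at hmem
  have := congr_fun hmem 0
  rw [colMap_apply, Matrix.single_apply_same, Pi.zero_apply] at this
  exact one_ne_zero this

/-- **Full column support at a saturated point.** At a saturated invertible point of a computation of `⟨2,2,n⟩`
(`|O| = 2n`), for every column `c` some term vanishing at `X₀` has an output with a nonzero entry in column `c`:
otherwise every admissible space has dead column `c` and Rado necessity fails for `T = O` (`2n ≤ dim < 2n`). So the
footprint space `WW = span{W_i : i ∉ O}` has no zero column — the catalog's 'no `L₀` block' convention. -/
theorem exists_w_col_ne_zero_of_saturated (β : BilinComp (mulBilin k 2 2 n) ι) (X₀ : Matrix (Fin 2) (Fin 2) k)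
    (hX₀ : IsUnit X₀.det) (O : Finset ι) (hO : ∀ i, i ∉ O → β.f i X₀ = 0) (hO' : ∀ i ∈ O, β.f i X₀ ≠ 0)
    (hcard : O.card = 2 * n) (c : Fin n) : ∃ i, i ∉ O ∧ ∃ r, β.w i r c ≠ 0 := by
  classical
  by_contra hall
  push Not at hall
  set WW : Submodule k (Matrix (Fin 2) (Fin n) k) := Submodule.span k (β.w '' {i | i ∉ O}) with hWWdef
  have hWW : ∀ W ∈ WW, ∀ r, W r c = 0 := by
    intro W hW r
    induction hW using Submodule.span_induction with
    | mem x hx =>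
        obtain ⟨i, hi, rfl⟩ := hx
        exact hall i hi r
    | zero => rfl
    | add x y _ _ hx hy => rw [Matrix.add_apply, hx, hy, add_zero]
    | smul a x _ hx => rw [Matrix.smul_apply, hx, smul_eq_mul, mul_zero]
  have hle : (⨆ j ∈ O, fpSpace (LinearMap.ker (β.f j)) WW : Submodule k (Matrix (Fin 2) (Fin n) k)) ≤
      LinearMap.ker (colMap c) := by
    refine iSup₂_le fun j _ => ?_
    intro W hW
    rw [LinearMap.mem_ker]
    ext r
    rw [colMap_apply, Pi.zero_apply]
    exact fpSpace_col_eq_zero (β.f j) hWW hW r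
  have h1 := card_le_finrank_biSup_fpSpace β X₀ hX₀ O hO hO' hcard WW le_rfl O (subset_refl O)
  have h2 := Submodule.finrank_mono hle
  have h3 := Submodule.finrank_lt (ker_colMap_ne_top (k := k) (n := n) c)
  rw [finrank_matrix_fin] at h3
  omega

/-! ## Structure of the admissible space of a rank-one class (`m = 2`) -/

/-- In `k²`, the line `θ^⊥` (`θ ≠ 0`) is spanned by any of its nonzero vectors `κ`. -/
theorem exists_eq_smul_of_dotProduct_eq_zero {θ κ y : Fin 2 → k} (hθ : θ ≠ 0) (hκ : κ ≠ 0) (hθκ : θ ⬝ᵥ κ = 0)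
    (hy : θ ⬝ᵥ y = 0) : ∃ c : k, y = c • κ := by
  simp only [dotProduct, Fin.sum_univ_two] at hθκ hy
  by_cases h1 : θ 1 = 0
  · have h0 : θ 0 ≠ 0 := by
      intro h0; apply hθ; ext i; fin_cases i <;> simp [h0, h1]
    rw [h1, zero_mul, add_zero] at hθκ hy
    have hκ0 : κ 0 = 0 := (mul_eq_zero.mp hθκ).resolve_left h0
    have hy0 : y 0 = 0 := (mul_eq_zero.mp hy).resolve_left h0
    have hκ1 : κ 1 ≠ 0 := by
      intro hκ1; apply hκ; ext i; fin_cases i <;> simp [hκ0, hκ1]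
    refine ⟨y 1 * (κ 1)⁻¹, ?_⟩
    ext i; fin_cases i
    · simp [hκ0, hy0]
    · simp [hκ1]
  · have hκ1 : κ 1 = -(θ 0 * κ 0) * (θ 1)⁻¹ := by
      field_simp
      linear_combination hθκ
    have hy1 : y 1 = -(θ 0 * y 0) * (θ 1)⁻¹ := by
      field_simp
      linear_combination hy
    have hκ0 : κ 0 ≠ 0 := by
      intro hκ0; apply hκ; ext i; fin_cases i
      · simpa using hκ0
      · simp [hκ1, hκ0]
    refine ⟨y 0 * (κ 0)⁻¹, ?_⟩
    ext i; fin_cases i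
    · simp [hκ0]
    · simp only [Fin.mk_one, Pi.smul_apply, smul_eq_mul]
      rw [hy1, hκ1]
      field_simp

/-- If `θᵀμ ≠ 0` and `κ ≠ 0` spans `θ^⊥`, then `(μ, κ)` is a basis of `k²`: `det(μ, κ) ≠ 0`. -/
theorem det_ne_zero_of_dotProduct {θ μ κ : Fin 2 → k} (hθμ : θ ⬝ᵥ μ ≠ 0) (hκ : κ ≠ 0) (hθκ : θ ⬝ᵥ κ = 0) :
    μ 1 * κ 0 - μ 0 * κ 1 ≠ 0 := by
  intro hD
  have hμ : μ ≠ 0 := by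
    rintro rfl; exact hθμ (dotProduct_zero θ)
  -- `ψ = (μ₁, −μ₀)` is orthogonal to `μ` and, by `hD`, to `κ`; so `μ ∈ ψ^⊥ = k κ` and `θᵀμ = 0`
  set ψ : Fin 2 → k := ![μ 1, -μ 0] with hψ
  have hψne : ψ ≠ 0 := by
    intro h
    apply hμ
    have h0 := congr_fun h 0
    have h1 := congr_fun h 1
    simp only [hψ, Matrix.cons_val_zero, Matrix.cons_val_one, Pi.zero_apply, neg_eq_zero] at h0 h1
    ext i; fin_cases i
    · exact h1
    · exact h0
  have hψκ : ψ ⬝ᵥ κ = 0 := by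
    simp only [hψ, dotProduct, Fin.sum_univ_two, Matrix.cons_val_zero, Matrix.cons_val_one]
    linear_combination hD
  have hψμ : ψ ⬝ᵥ μ = 0 := by
    simp only [hψ, dotProduct, Fin.sum_univ_two, Matrix.cons_val_zero, Matrix.cons_val_one]
    ring
  obtain ⟨c, hc⟩ := exists_eq_smul_of_dotProduct_eq_zero hψne hκ hψκ hψμ
  apply hθμ
  rw [hc, dotProduct_smul, hθκ, smul_zero]

/-- Every `W ∈ k^{2×n}` decomposes along a basis `(μ, κ)` of `k²`: `W = μ ⊗ a + κ ⊗ b`. -/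
theorem exists_eq_vecMulVec_add_vecMulVec {μ κ : Fin 2 → k} (hD : μ 1 * κ 0 - μ 0 * κ 1 ≠ 0)
    (W : Matrix (Fin 2) (Fin n) k) : ∃ a b : Fin n → k, W = vecMulVec μ a + vecMulVec κ b := by
  obtain ⟨D, hDdef⟩ : ∃ D : k, D = μ 1 * κ 0 - μ 0 * κ 1 := ⟨_, rfl⟩
  have hD0 : D ≠ 0 := hDdef ▸ hD
  refine ⟨fun j => (κ 0 * W 1 j - κ 1 * W 0 j) * D⁻¹, fun j => (μ 1 * W 0 j - μ 0 * W 1 j) * D⁻¹, ?_⟩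
  ext r j
  fin_cases r
  · simp only [Fin.zero_eta, Matrix.add_apply, vecMulVec_apply]
    have e : μ 0 * (κ 0 * W 1 j - κ 1 * W 0 j) + κ 0 * (μ 1 * W 0 j - μ 0 * W 1 j) = D * W 0 j := by
      rw [hDdef]; ring
    calc W 0 j = D * W 0 j * D⁻¹ := by rw [mul_comm D, mul_assoc, mul_inv_cancel₀ hD0, mul_one]
      _ = _ := by rw [← e]; ring
  · simp only [Fin.mk_one, Matrix.add_apply, vecMulVec_apply]
    have e : μ 1 * (κ 0 * W 1 j - κ 1 * W 0 j) + κ 1 * (μ 1 * W 0 j - μ 0 * W 1 j) = D * W 1 j := by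
      rw [hDdef]; ring
    calc W 1 j = D * W 1 j * D⁻¹ := by rw [mul_comm D, mul_assoc, mul_inv_cancel₀ hD0, mul_one]
      _ = _ := by rw [← e]; ring

/-- **Admissible space of a RANK-ONE off-class (structure).** Let the X-form be `f(X) = θᵀ X μ` (marginal `θ μᵀ`) with
`f(1) = θᵀμ ≠ 0`, and let `κ ≠ 0` span `θ^⊥` (so `ker f = {X : Xμ ∈ kκ}`). Then for all `a, b ∈ kⁿ`:
`μ ⊗ a + κ ⊗ b ∈ B_{ker f}(WW)` iff `κ ⊗ a ∈ WW` and `y ⊗ b ∈ WW` for every `y ∈ k²`. Consequently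
`dim B_{ker f}(WW) = dim{a : κ⊗a ∈ WW} + dim{b : k²⊗b ⊆ WW}`, the two numbers the engine reads off a pencil type. -/
theorem vecMulVec_add_vecMulVec_mem_fpSpace_iff (f : Module.Dual k (Matrix (Fin 2) (Fin 2) k)) {θ μ κ : Fin 2 → k}
    (hf : ∀ X, f X = θ ⬝ᵥ (X *ᵥ μ)) (hθμ : θ ⬝ᵥ μ ≠ 0) (hκ : κ ≠ 0) (hθκ : θ ⬝ᵥ κ = 0)
    (WW : Submodule k (Matrix (Fin 2) (Fin n) k)) (a b : Fin n → k) :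
    vecMulVec μ a + vecMulVec κ b ∈ fpSpace (LinearMap.ker f) WW ↔
      vecMulVec κ a ∈ WW ∧ ∀ y : Fin 2 → k, vecMulVec y b ∈ WW := by
  have hθ : θ ≠ 0 := by
    rintro rfl; exact hθμ (zero_dotProduct μ)
  constructor
  · intro h
    constructor
    · -- `X₁ = (θᵀμ)⁻¹ κ θᵀ`: `X₁ μ = κ`, `X₁ κ = 0`, `f X₁ = θᵀκ = 0`
      set X₁ : Matrix (Fin 2) (Fin 2) k := (θ ⬝ᵥ μ)⁻¹ • vecMulVec κ θ with hX₁
      have hX₁v : ∀ v, X₁ *ᵥ v = ((θ ⬝ᵥ μ)⁻¹ * (θ ⬝ᵥ v)) • κ := fun v => by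
        rw [hX₁, Matrix.smul_mulVec, vecMulVec_mulVec, op_smul_eq_smul, smul_smul]
      have hX₁μ : X₁ *ᵥ μ = κ := by rw [hX₁v, inv_mul_cancel₀ hθμ, one_smul]
      have hX₁κ : X₁ *ᵥ κ = 0 := by rw [hX₁v, hθκ, mul_zero, zero_smul]
      have hX₁ker : X₁ ∈ LinearMap.ker f := by rw [LinearMap.mem_ker, hf, hX₁μ, hθκ]
      have := h X₁ hX₁ker
      rwa [Matrix.mul_add, mul_vecMulVec, mul_vecMulVec, hX₁μ, hX₁κ, zero_vecMulVec, add_zero] at this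
    · intro y
      -- `X₂ = (ψᵀκ)⁻¹ y ψᵀ` with `ψ ⊥ μ`: `X₂ μ = 0`, `X₂ κ = y`, `f X₂ = 0`
      have hD := det_ne_zero_of_dotProduct hθμ hκ hθκ
      set ψ : Fin 2 → k := ![μ 1, -μ 0] with hψ
      have hψμ : ψ ⬝ᵥ μ = 0 := by
        simp only [hψ, dotProduct, Fin.sum_univ_two, Matrix.cons_val_zero, Matrix.cons_val_one]; ring
      have hψκ : ψ ⬝ᵥ κ = μ 1 * κ 0 - μ 0 * κ 1 := by
        simp only [hψ, dotProduct, Fin.sum_univ_two, Matrix.cons_val_zero, Matrix.cons_val_one]; ring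
      set X₂ : Matrix (Fin 2) (Fin 2) k := (ψ ⬝ᵥ κ)⁻¹ • vecMulVec y ψ with hX₂
      have hX₂v : ∀ v, X₂ *ᵥ v = ((ψ ⬝ᵥ κ)⁻¹ * (ψ ⬝ᵥ v)) • y := fun v => by
        rw [hX₂, Matrix.smul_mulVec, vecMulVec_mulVec, op_smul_eq_smul, smul_smul]
      have hX₂μ : X₂ *ᵥ μ = 0 := by rw [hX₂v, hψμ, mul_zero, zero_smul]
      have hX₂κ : X₂ *ᵥ κ = y := by rw [hX₂v, hψκ, inv_mul_cancel₀ hD, one_smul]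
      have hX₂ker : X₂ ∈ LinearMap.ker f := by rw [LinearMap.mem_ker, hf, hX₂μ, dotProduct_zero]
      have := h X₂ hX₂ker
      rwa [Matrix.mul_add, mul_vecMulVec, mul_vecMulVec, hX₂μ, hX₂κ, zero_vecMulVec, zero_add] at this
  · rintro ⟨ha, hb⟩ X hX
    rw [LinearMap.mem_ker, hf] at hX
    obtain ⟨c, hc⟩ := exists_eq_smul_of_dotProduct_eq_zero hθ hκ hθκ hX
    rw [Matrix.mul_add, mul_vecMulVec, mul_vecMulVec, hc, smul_vecMulVec]
    exact WW.add_mem (WW.smul_mem c ha) (hb _)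

/-- **Rank-one admissible vectors of a class that does not factor through `X ↦ Xu` lie in `WW`.** If some `X'` has
`X' u = 0` but `f X' ≠ 0` (for an INVERTIBLE marginal this holds for every `u ≠ 0`; for a rank-one marginal `θμᵀ` for
every `u ∉ kμ`), then `u ⊗ v ∈ B_{ker f}(WW)` forces `y ⊗ v ∈ WW` for every `y ∈ k²` — in particular `u ⊗ v ∈ WW`.
(So at a saturated point an off-term whose twisted output is independent of `WW` and whose class does not factor
has a rank-two output.) -/
theorem vecMulVec_mem_of_mem_fpSpace (f : Module.Dual k (Matrix (Fin 2) (Fin 2) k)) {u : Fin 2 → k} (hu : u ≠ 0)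
    (hX' : ∃ X' : Matrix (Fin 2) (Fin 2) k, X' *ᵥ u = 0 ∧ f X' ≠ 0) {WW : Submodule k (Matrix (Fin 2) (Fin n) k)}
    {v : Fin n → k} (h : vecMulVec u v ∈ fpSpace (LinearMap.ker f) WW) (y : Fin 2 → k) : vecMulVec y v ∈ WW := by
  obtain ⟨X', hX'u, hfX'⟩ := hX'
  obtain ⟨i, hi⟩ := Function.ne_iff.mp hu
  set X'' : Matrix (Fin 2) (Fin 2) k := vecMulVec y (Pi.single i (u i)⁻¹) with hX''
  have hX''u : X'' *ᵥ u = y := by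
    rw [hX'', vecMulVec_mulVec, single_dotProduct, inv_mul_cancel₀ hi, MulOpposite.op_one, one_smul]
  set X : Matrix (Fin 2) (Fin 2) k := X'' - (f X'' * (f X')⁻¹) • X' with hX
  have hXker : X ∈ LinearMap.ker f := by
    rw [LinearMap.mem_ker, hX, map_sub, map_smul, smul_eq_mul, mul_assoc, inv_mul_cancel₀ hfX', mul_one, sub_self]
  have hXu : X *ᵥ u = y := by
    rw [hX, Matrix.sub_mulVec, Matrix.smul_mulVec, hX'u, smul_zero, sub_zero, hX''u]
  have hmem := h X hXker
  rwa [mul_vecMulVec, hXu] at hmem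

/-- **Corollary at a saturated point.** If the off-term `j ∈ O` does not factor through `X ↦ Xu` and its twisted output
is rank one with column vector `u`, `X₀⁻¹ W_j = u ⊗ v`, then `X₀⁻¹ W_j` already lies in `span{W_i : i ∉ O}`. -/
theorem inv_mul_w_mem_span_of_eq_vecMulVec (β : BilinComp (mulBilin k 2 2 n) ι) (X₀ : Matrix (Fin 2) (Fin 2) k)
    (hX₀ : IsUnit X₀.det) (O : Finset ι) (hO : ∀ i, i ∉ O → β.f i X₀ = 0) (hO' : ∀ i ∈ O, β.f i X₀ ≠ 0)
    (hcard : O.card = 2 * n) {j : ι} (hj : j ∈ O) {u : Fin 2 → k} {v : Fin n → k} (hu : u ≠ 0)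
    (hX' : ∃ X' : Matrix (Fin 2) (Fin 2) k, X' *ᵥ u = 0 ∧ β.f j X' ≠ 0) (hW : X₀⁻¹ * β.w j = vecMulVec u v) :
    X₀⁻¹ * β.w j ∈ Submodule.span k (β.w '' {i | i ∉ O}) := by
  have h := inv_mul_w_mem_fpSpace β X₀ hX₀ O hO hO' hcard hj
  rw [hW] at h ⊢
  exact vecMulVec_mem_of_mem_fpSpace (β.f j) hu hX' h u

end Summit.MatrixMultiplication.OmegaCensus.SmallFormats
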